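import Mathlib
import Literature.Analysis.FluidPDE.GaussianVortexPlanar
import HarnessLib
import Summits.AnomalousDissipation.AnomalousDissipation.Theorems.MarginalStabilityChainStretchedVortexRowsStubLogPotentialTools
import Summits.AnomalousDissipation.AnomalousDissipation.Theorems.MarginalStabilityChainStretchedVortexRowsStubLogPotentialSymmetry

/-!
# `logPotential_neutral_bounded` — registered helper stub toward `stub_cellStreamSolvability`
(crux stmt-AnomalousDissipation-3009 `MarginalStabilityChain.StretchedVortexRows`, line `braid-closed-large-circulation-gluing`)

The logarithmic potential `ψ = N ∗ g`, `N = (2π)⁻¹ log ‖·‖`, of a measurable density on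
`ℝ² = EuclideanSpace ℝ (Fin 2)` with the Gaussian bound `|g| ≤ B e^{−‖η‖²/8}` and TOTAL MASS ZERO `∫ g = 0`
is bounded on `ℝ²` (without neutrality it grows like `log ‖ξ‖`).

Proof route.
* On the unit ball `‖ξ‖ < 1` the crude growth bound `abs_logPotential_le` gives `|ψ(ξ)| ≤ C₁ (1 + log(1 + ‖ξ‖)) ≤ 2 C₁`.
* For `1 ≤ ‖ξ‖`, neutrality gives `ψ(ξ) = ∫ (N(ξ − η) − N(ξ)) g(η) dη`. On the near region `‖η‖ < ‖ξ‖/2` one has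
  `‖ξ − η‖/‖ξ‖ ∈ (1/2, 3/2)`, whence `|log ‖ξ − η‖ − log ‖ξ‖| ≤ 1`; on the far region `‖η‖ ≥ ‖ξ‖/2` the three-term
  majorant `|log ‖ξ − η‖| ≤ L₀(ξ − η) + log(1 + ‖ξ‖) + ‖η‖` (`L₀ = 𝟙_{‖z‖<1}(−log ‖z‖) ∈ L¹`) together with
  `0 ≤ log ‖ξ‖ ≤ log(1 + ‖ξ‖) ≤ ‖ξ‖ ≤ 2‖η‖` gives `|log ‖ξ − η‖ − log ‖ξ‖| ≤ L₀(ξ − η) + 5‖η‖`. Hence in both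
  regions `|(N(ξ − η) − N(ξ)) g(η)| ≤ (2π)⁻¹ B (L₀(ξ − η) + 5 (1 + ‖η‖) e^{−‖η‖²/8})`, an integrable majorant whose
  integral `(2π)⁻¹ B (∫ L₀ + 5 ∫ (1 + ‖η‖) e^{−‖η‖²/8})` does not depend on `ξ` (translation invariance).
-/

set_option linter.dupNamespace false

noncomputable section

open scoped BigOperators Topology RealInnerProductSpace ContDiff Laplacian
open Filter Set Function MeasureTheory WithLp Metric

namespace Summit.AnomalousDissipation.AnomalousDissipation.Theorems.MarginalStabilityChainStretchedVortexRows

open Literature.Analysis.FluidPDE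

/-! ### Integrability for a measurable Gaussian-bounded density -/

/-- A measurable Gaussian-bounded density is integrable. [folklore] -/
theorem neutralBdd_integrable {B : ℝ} {g : EuclideanSpace ℝ (Fin 2) → ℝ} (hgm : Measurable g)
    (hg0 : ∀ η, |g η| ≤ B * Real.exp (-(1 / 8) * ‖η‖ ^ 2)) : Integrable g := by
  have h0 := integrable_one_add_norm_pow_mul_exp_eighth 0
  simp only [pow_zero, one_mul] at h0
  exact (h0.const_mul B).mono' hgm.aestronglyMeasurable (Eventually.of_forall fun η => by
    rw [Real.norm_eq_abs]; exact hg0 η)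

/-- The integrand `N(ξ − η) g(η)` of the logarithmic potential of a measurable Gaussian-bounded density is
integrable in `η`. [folklore] -/
theorem neutralBdd_integrable_logKernel_mul {B : ℝ} {g : EuclideanSpace ℝ (Fin 2) → ℝ} (hgm : Measurable g)
    (hg0 : ∀ η, |g η| ≤ B * Real.exp (-(1 / 8) * ‖η‖ ^ 2)) (ξ : EuclideanSpace ℝ (Fin 2)) :
    Integrable fun η : EuclideanSpace ℝ (Fin 2) => (2 * Real.pi)⁻¹ * Real.log ‖ξ - η‖ * g η := by
  refine (integrable_abs_logKernel_mul_exp hg0 ξ).mono'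
    ((measurable_const.mul ((measurable_const.sub measurable_id).norm.log)).mul hgm).aestronglyMeasurable
    (Eventually.of_forall fun η => ?_)
  rw [Real.norm_eq_abs, abs_mul]
  exact mul_le_mul_of_nonneg_left (hg0 η) (abs_nonneg _)

/-! ### The two-region estimate of `log ‖ξ − η‖ − log ‖ξ‖` -/

/-- Near region: for `‖η‖ < ‖ξ‖/2`, `‖ξ − η‖/‖ξ‖ ∈ (1/2, 3/2)` and so `|log ‖ξ − η‖ − log ‖ξ‖| ≤ 1`
(`log x ≤ x − 1` applied to `x` and `x⁻¹`). [folklore] -/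
theorem neutralBdd_abs_log_sub_log_le_near {ξ η : EuclideanSpace ℝ (Fin 2)} (hη : ‖η‖ < ‖ξ‖ / 2) :
    |Real.log ‖ξ - η‖ - Real.log ‖ξ‖| ≤ 1 := by
  have hξ : 0 < ‖ξ‖ := by linarith [norm_nonneg η]
  have h1 : ‖ξ‖ / 2 < ‖ξ - η‖ := by linarith [norm_sub_norm_le ξ η]
  have h2 : ‖ξ - η‖ ≤ 2 * ‖ξ‖ := by linarith [norm_sub_le ξ η, norm_nonneg ξ]
  have hpos : 0 < ‖ξ - η‖ := by linarith
  have hx : 0 < ‖ξ - η‖ / ‖ξ‖ := by positivity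
  rw [← Real.log_div hpos.ne' hξ.ne', abs_le]
  constructor
  · have h := Real.log_le_sub_one_of_pos (inv_pos.2 hx)
    rw [Real.log_inv] at h
    have h3 : (‖ξ - η‖ / ‖ξ‖)⁻¹ ≤ 2 := by
      rw [inv_div, div_le_iff₀ hpos]; linarith
    linarith
  · have h := Real.log_le_sub_one_of_pos hx
    have h3 : ‖ξ - η‖ / ‖ξ‖ ≤ 2 := by
      rw [div_le_iff₀ hξ]; linarith
    linarith

/-- Far region: for `1 ≤ ‖ξ‖` and `‖ξ‖/2 ≤ ‖η‖`, `|log ‖ξ − η‖ − log ‖ξ‖| ≤ L₀(ξ − η) + 5‖η‖`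
(three-term majorant and `0 ≤ log ‖ξ‖ ≤ log(1 + ‖ξ‖) ≤ ‖ξ‖ ≤ 2‖η‖`). [folklore] -/
theorem neutralBdd_abs_log_sub_log_le_far {ξ η : EuclideanSpace ℝ (Fin 2)} (hξ : 1 ≤ ‖ξ‖) (hη : ‖ξ‖ / 2 ≤ ‖η‖) :
    |Real.log ‖ξ - η‖ - Real.log ‖ξ‖| ≤
      (ball (0 : EuclideanSpace ℝ (Fin 2)) 1).indicator (fun z => -Real.log ‖z‖) (ξ - η) + 5 * ‖η‖ := by
  have h1 := abs_log_norm_sub_le ξ η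
  have h2 : Real.log (1 + ‖ξ‖) ≤ ‖ξ‖ := by
    have := Real.log_le_sub_one_of_pos (by positivity : (0:ℝ) < 1 + ‖ξ‖)
    linarith
  have h3 : |Real.log ‖ξ‖| ≤ ‖ξ‖ := by
    rw [abs_of_nonneg (Real.log_nonneg hξ)]
    have := Real.log_le_sub_one_of_pos (by linarith : (0:ℝ) < ‖ξ‖)
    linarith
  have h4 := abs_sub (Real.log ‖ξ - η‖) (Real.log ‖ξ‖)
  linarith

/-- The `ξ`-uniform integrable majorant of the neutralised integrand for `1 ≤ ‖ξ‖`: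
`|(N(ξ − η) − N(ξ)) g(η)| ≤ (2π)⁻¹ B (L₀(ξ − η) + 5 (1 + ‖η‖) e^{−‖η‖²/8})`. [folklore] -/
theorem neutralBdd_norm_sub_mul_le {B : ℝ} {g : EuclideanSpace ℝ (Fin 2) → ℝ}
    (hg0 : ∀ η, |g η| ≤ B * Real.exp (-(1 / 8) * ‖η‖ ^ 2)) {ξ : EuclideanSpace ℝ (Fin 2)} (hξ : 1 ≤ ‖ξ‖)
    (η : EuclideanSpace ℝ (Fin 2)) :
    ‖((2 * Real.pi)⁻¹ * Real.log ‖ξ - η‖ - (2 * Real.pi)⁻¹ * Real.log ‖ξ‖) * g η‖ ≤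
      (2 * Real.pi)⁻¹ * B *
        ((ball (0 : EuclideanSpace ℝ (Fin 2)) 1).indicator (fun z => -Real.log ‖z‖) (ξ - η) +
          5 * ((1 + ‖η‖) ^ 1 * Real.exp (-(1 / 8) * ‖η‖ ^ 2))) := by
  have hB : 0 ≤ B := (abs_nonneg _).trans ((hg0 0).trans (le_of_eq (by simp)))
  have hc : (0:ℝ) < (2 * Real.pi)⁻¹ := by positivity
  rw [Real.norm_eq_abs, abs_mul, ← mul_sub, abs_mul, abs_of_pos hc]
  have h4 := indicator_neg_log_norm_nonneg (ξ - η)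
  have he0 : 0 ≤ Real.exp (-(1 / 8) * ‖η‖ ^ 2) := (Real.exp_pos _).le
  have he1 : Real.exp (-(1 / 8) * ‖η‖ ^ 2) ≤ 1 := Real.exp_le_one_iff.2 (by nlinarith [norm_nonneg η])
  have hg := hg0 η
  set L0 := (ball (0 : EuclideanSpace ℝ (Fin 2)) 1).indicator (fun z => -Real.log ‖z‖) (ξ - η) with hL0
  set e := Real.exp (-(1 / 8) * ‖η‖ ^ 2) with he
  have hηn := norm_nonneg η
  by_cases hη : ‖η‖ < ‖ξ‖ / 2
  · have hd := neutralBdd_abs_log_sub_log_le_near hη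
    calc (2 * Real.pi)⁻¹ * |Real.log ‖ξ - η‖ - Real.log ‖ξ‖| * |g η|
        ≤ (2 * Real.pi)⁻¹ * 1 * (B * e) :=
          mul_le_mul (mul_le_mul_of_nonneg_left hd hc.le) hg (abs_nonneg _) (by positivity)
      _ = (2 * Real.pi)⁻¹ * B * e := by ring
      _ ≤ (2 * Real.pi)⁻¹ * B * (L0 + 5 * ((1 + ‖η‖) ^ 1 * e)) := by
          refine mul_le_mul_of_nonneg_left ?_ (mul_nonneg hc.le hB)
          rw [pow_one]
          nlinarith [mul_nonneg hηn he0]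
  · rw [not_lt] at hη
    have hd := neutralBdd_abs_log_sub_log_le_far hξ hη
    have h6 : 0 ≤ L0 + 5 * ‖η‖ := by positivity
    calc (2 * Real.pi)⁻¹ * |Real.log ‖ξ - η‖ - Real.log ‖ξ‖| * |g η|
        ≤ (2 * Real.pi)⁻¹ * (L0 + 5 * ‖η‖) * (B * e) :=
          mul_le_mul (mul_le_mul_of_nonneg_left hd hc.le) hg (abs_nonneg _) (mul_nonneg hc.le h6)
      _ = (2 * Real.pi)⁻¹ * B * (L0 * e + 5 * (‖η‖ * e)) := by ring
      _ ≤ (2 * Real.pi)⁻¹ * B * (L0 + 5 * ((1 + ‖η‖) ^ 1 * e)) := by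
          refine mul_le_mul_of_nonneg_left ?_ (mul_nonneg hc.le hB)
          have i1 : L0 * e ≤ L0 := mul_le_of_le_one_right h4 he1
          have i2 : ‖η‖ * e ≤ (1 + ‖η‖) ^ 1 * e := by rw [pow_one]; nlinarith
          linarith

/-! ### The far-field bound from neutrality -/

/-- For `1 ≤ ‖ξ‖`: `|ψ(ξ)| ≤ (2π)⁻¹ B (∫ L₀ + 5 ∫ (1 + ‖η‖) e^{−‖η‖²/8})` for a NEUTRAL measurable
Gaussian-bounded density (`ψ(ξ) = ∫ (N(ξ − η) − N(ξ)) g(η) dη`, then the uniform majorant). [folklore] -/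
theorem neutralBdd_abs_logPotential_le_far {B : ℝ} {g : EuclideanSpace ℝ (Fin 2) → ℝ} (hgm : Measurable g)
    (hg0 : ∀ η, |g η| ≤ B * Real.exp (-(1 / 8) * ‖η‖ ^ 2)) (hneutral : ∫ η, g η = 0) :
    ∃ C : ℝ, 0 ≤ C ∧ ∀ ξ : EuclideanSpace ℝ (Fin 2), 1 ≤ ‖ξ‖ →
      |∫ η, (2 * Real.pi)⁻¹ * Real.log ‖ξ - η‖ * g η| ≤ C := by
  have hB : 0 ≤ B := (abs_nonneg _).trans ((hg0 0).trans (le_of_eq (by simp)))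
  set I₀ : ℝ := ∫ z, (ball (0 : EuclideanSpace ℝ (Fin 2)) 1).indicator (fun z => -Real.log ‖z‖) z with hI₀def
  set I₁ : ℝ := ∫ η : EuclideanSpace ℝ (Fin 2), (1 + ‖η‖) ^ 1 * Real.exp (-(1 / 8) * ‖η‖ ^ 2) with hI₁def
  have hI₀ : 0 ≤ I₀ := integral_nonneg indicator_neg_log_norm_nonneg
  have hI₁ : 0 ≤ I₁ := integral_nonneg fun η => by positivity
  refine ⟨(2 * Real.pi)⁻¹ * B * (I₀ + 5 * I₁), by positivity, fun ξ hξ => ?_⟩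
  have hgi : Integrable g := neutralBdd_integrable hgm hg0
  have h1 := neutralBdd_integrable_logKernel_mul hgm hg0 ξ
  have h2 : Integrable fun η : EuclideanSpace ℝ (Fin 2) => (2 * Real.pi)⁻¹ * Real.log ‖ξ‖ * g η :=
    hgi.const_mul _
  -- neutrality
  have hkey : ∫ η, (2 * Real.pi)⁻¹ * Real.log ‖ξ - η‖ * g η =
      ∫ η, ((2 * Real.pi)⁻¹ * Real.log ‖ξ - η‖ - (2 * Real.pi)⁻¹ * Real.log ‖ξ‖) * g η := by
    simp_rw [sub_mul]
    rw [integral_sub h1 h2, integral_const_mul ((2 * Real.pi)⁻¹ * Real.log ‖ξ‖) g, hneutral, mul_zero,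
      sub_zero]
  rw [hkey]
  -- the majorant and its integral
  have hi0 : Integrable fun η : EuclideanSpace ℝ (Fin 2) =>
      (ball (0 : EuclideanSpace ℝ (Fin 2)) 1).indicator (fun z => -Real.log ‖z‖) (ξ - η) :=
    integrable_indicator_neg_log_norm.comp_sub_left ξ
  have hi15 : Integrable fun η : EuclideanSpace ℝ (Fin 2) =>
      5 * ((1 + ‖η‖) ^ 1 * Real.exp (-(1 / 8) * ‖η‖ ^ 2)) :=
    (integrable_one_add_norm_pow_mul_exp_eighth 1).const_mul 5
  have hFint : Integrable fun η : EuclideanSpace ℝ (Fin 2) => (2 * Real.pi)⁻¹ * B *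
      ((ball (0 : EuclideanSpace ℝ (Fin 2)) 1).indicator (fun z => -Real.log ‖z‖) (ξ - η) +
        5 * ((1 + ‖η‖) ^ 1 * Real.exp (-(1 / 8) * ‖η‖ ^ 2))) := (hi0.add hi15).const_mul _
  have hFI : ∫ η : EuclideanSpace ℝ (Fin 2), (2 * Real.pi)⁻¹ * B *
      ((ball (0 : EuclideanSpace ℝ (Fin 2)) 1).indicator (fun z => -Real.log ‖z‖) (ξ - η) +
        5 * ((1 + ‖η‖) ^ 1 * Real.exp (-(1 / 8) * ‖η‖ ^ 2))) = (2 * Real.pi)⁻¹ * B * (I₀ + 5 * I₁) := by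
    rw [integral_const_mul, integral_add hi0 hi15, integral_const_mul,
      integral_sub_left_eq_self
        ((ball (0 : EuclideanSpace ℝ (Fin 2)) 1).indicator (fun z => -Real.log ‖z‖)) volume ξ]
  calc |∫ η, ((2 * Real.pi)⁻¹ * Real.log ‖ξ - η‖ - (2 * Real.pi)⁻¹ * Real.log ‖ξ‖) * g η|
      = ‖∫ η, ((2 * Real.pi)⁻¹ * Real.log ‖ξ - η‖ - (2 * Real.pi)⁻¹ * Real.log ‖ξ‖) * g η‖ :=
        (Real.norm_eq_abs _).symm
    _ ≤ ∫ η : EuclideanSpace ℝ (Fin 2), (2 * Real.pi)⁻¹ * B *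
          ((ball (0 : EuclideanSpace ℝ (Fin 2)) 1).indicator (fun z => -Real.log ‖z‖) (ξ - η) +
            5 * ((1 + ‖η‖) ^ 1 * Real.exp (-(1 / 8) * ‖η‖ ^ 2))) :=
        norm_integral_le_of_norm_le hFint (Eventually.of_forall (neutralBdd_norm_sub_mul_le hg0 hξ))
    _ = (2 * Real.pi)⁻¹ * B * (I₀ + 5 * I₁) := hFI

/-! ### The registered stub -/

/-- **The logarithmic potential of a NEUTRAL density is bounded**: for a measurable `g` with
`|g| ≤ B e^{−‖η‖²/8}` and `∫ g = 0`, the potential `ψ = N ∗ g` (`N = (2π)⁻¹ log ‖·‖`) satisfies `|ψ(ξ)| ≤ C` on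
all of `ℝ²` (unit ball: crude growth bound `abs_logPotential_le`; `1 ≤ ‖ξ‖`: neutrality and the two-region
estimate `neutralBdd_abs_logPotential_le_far`). Registered helper (W5) toward `stub_cellStreamSolvability`. [folklore] -/
theorem logPotential_neutral_bounded :
    ∀ (B : ℝ) (g : EuclideanSpace ℝ (Fin 2) → ℝ), Measurable g →
      (∀ η, |g η| ≤ B * Real.exp (-(1 / 8) * ‖η‖ ^ 2)) → (∫ η, g η = 0) →
      ∃ C : ℝ, ∀ ξ : EuclideanSpace ℝ (Fin 2), |∫ η, (2 * Real.pi)⁻¹ * Real.log ‖ξ - η‖ * g η| ≤ C := by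
  intro B g hgm hg0 hneutral
  obtain ⟨C₁, hC₁0, hC₁⟩ := abs_logPotential_le hg0
  obtain ⟨C₂, hC₂0, hC₂⟩ := neutralBdd_abs_logPotential_le_far hgm hg0 hneutral
  refine ⟨2 * C₁ + C₂, fun ξ => ?_⟩
  by_cases hξ : 1 ≤ ‖ξ‖
  · linarith [hC₂ ξ hξ]
  · rw [not_le] at hξ
    have hl : Real.log (1 + ‖ξ‖) ≤ 1 := by
      have := Real.log_le_sub_one_of_pos (by positivity : (0:ℝ) < 1 + ‖ξ‖)
      linarith
    have h := hC₁ ξ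
    have h2 : C₁ * (1 + Real.log (1 + ‖ξ‖)) ≤ C₁ * 2 := mul_le_mul_of_nonneg_left (by linarith) hC₁0
    linarith

end Summit.AnomalousDissipation.AnomalousDissipation.Theorems.MarginalStabilityChainStretchedVortexRows

end
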